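import Literature.Analysis.FluidPDE.PassiveVectorTensorDistortedDuality
import Literature.Analysis.FluidPDE.PassiveVectorTensorFourier
import Mathlib.Analysis.CStarAlgebra.Matrix
import HarnessLib

/-!
# The distorted weak class with a CONSTANT frame `G ≡ G₀`, mode by mode
# (constant-frame twin of `PassiveVectorTensorFourier`)

Analysis/FluidPDE proof-support file (everything proved; no definitions, no named facts).
For the `G`-distorted weak class `Torus.IsWeakTensorPassiveVectorDistortedOn A T 𝔸 b G w₀ w` of
`PassiveVectorTensorDistorted.lean` (`∂ₜw + (b·∇)w + A (w·∇)b + Gᵀ∇π = 𝓛^G w`, `∇·(G w) = 0`, tested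
against time-Lipschitz space-smooth fields `Ψ` with `∇·(G Ψ) = 0`) we record

* §1 the kinematic mode-integrability API of the flat file (`integrableOn_mFourierCoeff`,
  `ae_integrable_slice`, `integrableOn_modeRHS`, …) — verbatim twins, any `G`;
* §2 for a CONSTANT frame `G = fun _ _ => G₀` (a fixed real matrix; no determinant or invertibility
  hypothesis): the viscous test operator is the FLAT one of the conjugated tensor,
  `viscAdjVar (fun _ => 𝔸^{G₀}) Ψ = viscAdj (𝔸^{G₀}) Ψ` (`viscAdjVar_const`), so the weak formulation
  tested with `η(t) • Γ(y)` for a STEADY smooth field `Γ` with `∇·(G₀ Γ) = 0` reads exactly as the flat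
  one with tensor `𝔸^{G₀} = Visc4.conj G₀ 𝔸` (`setIntegral_test_smul_constFrame`), and the steady-field
  pairing identity `∫⟪w(t), Γ⟫ = ∫⟪w₀, Γ⟫ + ∫_{(0,t]}(…)` holds for a.e. `t` (`ae_integral_inner_eq_constFrame`);
* §3 the algebra of a single real mode under a constant distortion:
  `G₀ • Re(e_k • z) = Re(e_k • G₀z)` (`distort_const_realTrigPoly`), so `Re(e_k • z)` is an admissible
  steady test iff `z` is transversal to the TWISTED frequency `G₀ᵀk`
  (`Σ_b (Σ_a k_a G₀ab) z_b = 0`, i.e. `((k : ℝ^d) ᵥ* G₀) · z = 0`; `isDivFree_distort_const_realTrigPoly_singleton`);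
* §4 **the constant-frame modewise integral identity**: for every `k ∈ ℤ^d` and every `z ∈ ℂ^d`
  transversal to `G₀ᵀk`, for a.e. `t ∈ (0,T)`,
  `⟪ŵ(t)(k), z⟫ = ⟪ŵ₀(k), z⟫ + ∫_{(0,t]} (−4π² ⟪ŵ(τ)(k), T_{𝔸^{G₀}}(k) z⟫
      + ∑ⱼ 2πi kⱼ ⟪𝓕(bⱼ w)(τ)(k), z⟫ + A ∑ⱼ 2πi kⱼ ⟪𝓕(wⱼ b)(τ)(k), z⟫) dτ`
  (`IsWeakTensorPassiveVectorDistortedOn.ae_inner_mFourierCoeff_eq_constFrame`) — the flat identity with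
  two substitutions only: the constraint plane `k^⊥` becomes `(G₀ᵀk)^⊥` and the symbol matrix is that of
  the conjugated tensor, `T_{𝔸^{G₀}}(k) z = T_𝔸(G₀ᵀk) z` in the obvious sense; the drift / link structure
  is untouched (the carrier `b` is the flat one);
* §5 the distorted constraint in Fourier variables: `𝓕(G₀ • v)(k) = G₀ • v̂(k)` and, for a.e. `t`,
  `Σ_b (G₀ᵀk)_b ŵ(t)(k)_b = 0` for every `k` (the modes of `w(t)` are transversal to the twisted
  frequencies).

This is the y-space ("isometric") reading of the frozen-frame cell problem of Armstrong–Vicol's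
Lagrangian-coordinate ansatz (arXiv:2305.05048 §4.1, the equation for `T_{m−1}` with the distortion
`s_{m−1}` frozen): on the FIXED flat lattice the frozen frame twists only the fibre geometry
(constraint plane and viscous symbol), which is what the (V_θ) family `VmodDist.SlowVectorClauseFθg` of
route `SolenoidalFractalHomogenisation` (cell `ad-ideate`, K1L_D stmt-AnomalousDissipation-27980,
registered stub `stub_D1_V0θg`) quantifies over; this file is the first brick of the twisted sideband
chain and of the frozen-frame existence/uniqueness theory (N1 `FrozenDistortedExists`).  NOT here: the
continuous mode representatives / a.e. derivatives (twin of `…CellChainModes`), energy, existence,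
uniqueness.

## Mathlib / tree search

Tree: `PassiveVectorTensorDistortedDuality` (`setIntegral_test_smul_lipschitzField`,
`ae_integral_inner_lipschitzField_eq`, the D-class integrability API `integrable_inner_of_continuous`,
`integrable_inner_convect`, `integrable_inner_carrier_convect`, `integrable_norm_carrier_mul_norm`),
`PassiveVectorTensorDistorted` (`viscAdjVar_const`, `distort`, kinematic API), `PassiveVectorTensorFourier`
(`symbT`, `integral_inner_convect_add_viscAdj_realTrigPoly_singleton`), `PassiveVectorFourier`
(`integral_inner_convect_realTrigPoly_singleton`), `TorusFourierModes`
(`integral_inner_realTrigPoly_singleton`, `isDivFree_realTrigPoly_singleton`), `TorusTrigPoly`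
(`IsWeaklyDivFree.sum_mul_mFourierCoeff_eq_zero`), `re_integral_eq` / `im_integral_eq`
(`PassiveScalarFourier`). Mathlib: `Matrix.toEuclideanCLM` (the constant matrix as a continuous linear
map of `ℂ^d`, to pull it through `mFourierCoeff`), `Matrix.vecMul` (`(k : ℝ^d) ᵥ* G₀ = G₀ᵀk`).
No constant-frame statement existed (`rg "fun _ _ =>" Literature/Analysis/FluidPDE/*Distorted*`: only the
`G ≡ 1` bridges).

## References

* S. Armstrong, V. Vicol, *Anomalous diffusion by fractal homogenization*, Ann. PDE 11 (2025) /
  arXiv:2305.05048, §4.1 (PDF p. 34). [`ArmstrongVicol2025`]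
* R. J. DiPerna, P.-L. Lions, Invent. Math. 98 (1989), §II.1 (12)–(14). [`DiPernaLions1989`]
* R. Temam, *Navier–Stokes Equations* (3rd ed., 1984), Ch. III §1.1. [`Temam1984`]
* U. Frisch, *Turbulence* (CUP 1995), §9.6.3 eq. (9.57) p. 233. [`Frisch1995Turbulence`]
* J. C. Robinson, J. L. Rodrigo, W. Sadowski, *The three-dimensional Navier–Stokes equations* (CUP 2016),
  Ex. 2.14. [`RobinsonRodrigoSadowski2016`]
-/

noncomputable section

open MeasureTheory TopologicalSpace Set Function Filter Topology UnitAddTorus Complex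
open scoped ENNReal NNReal InnerProductSpace ComplexConjugate ContDiff

namespace Literature.Analysis.FluidPDE

namespace Torus

variable {d : Type*} [Fintype d] [DecidableEq d]

/-! ## §1 Integrability of the Fourier modes of a distorted weak solution (any frame `G`) -/

section ModeIntegrability

namespace IsWeakTensorPassiveVectorDistortedOn

variable {A T : ℝ} {𝔸 : Visc4 d} {b w : ℝ → UnitAddTorus d → EuclideanSpace ℝ d}
  {G : ℝ → UnitAddTorus d → Matrix d d ℝ} {w₀ : UnitAddTorus d → EuclideanSpace ℝ d}

/-- `complexify ∘ w ∈ L¹((0,T) × T^d; ℂ^d)` (distorted class). [cite: DiPernaLions1989, §II.1 (12)–(14)] -/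
theorem integrable_complexify_uncurry (h : IsWeakTensorPassiveVectorDistortedOn A T 𝔸 b G w₀ w) :
    Integrable (fun p : ℝ × UnitAddTorus d => FunctionSpaces.EuclideanSpace.complexify (w p.1 p.2))
      (((volume : Measure ℝ).restrict (Ioo 0 T)).prod volume) :=
  (FunctionSpaces.EuclideanSpace.complexify (ι := d)).toContinuousLinearMap.integrable_comp h.integrable_uncurry

/-- Integrability on `(0,T) × T^d` of `e_{-k}(x) • complexify (w(t,x))` (distorted class).
[cite: DiPernaLions1989, §II.1 (12)–(14)] -/
theorem integrable_mFourier_smul (h : IsWeakTensorPassiveVectorDistortedOn A T 𝔸 b G w₀ w) (k : d → ℤ) :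
    Integrable (fun p : ℝ × UnitAddTorus d =>
      mFourier (-k) p.2 • FunctionSpaces.EuclideanSpace.complexify (w p.1 p.2))
      (((volume : Measure ℝ).restrict (Ioo 0 T)).prod volume) :=
  h.integrable_complexify_uncurry.bdd_smul 1
    ((mFourier (-k)).continuous.comp continuous_snd).aestronglyMeasurable
    (Eventually.of_forall fun p => ((mFourier (-k)).norm_coe_le_norm p.2).trans_eq mFourier_norm)

/-- The Fourier modes `t ↦ ŵ(t)(k)` of a distorted weak solution are integrable on `(0,T)`.
[cite: DiPernaLions1989, §II.1 (12)–(14)] -/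
theorem integrableOn_mFourierCoeff (h : IsWeakTensorPassiveVectorDistortedOn A T 𝔸 b G w₀ w) (k : d → ℤ) :
    Integrable (fun t => mFourierCoeff (FunctionSpaces.EuclideanSpace.complexify ∘ w t) k)
      (volume.restrict (Ioo 0 T)) := by
  have e : (fun t => mFourierCoeff (FunctionSpaces.EuclideanSpace.complexify ∘ w t) k) =
      fun t => ∫ x, mFourier (-k) x • FunctionSpaces.EuclideanSpace.complexify (w t x) := by
    funext t
    rw [FunctionSpaces.Torus.mFourierCoeff_eq_integral_volume]
    rfl
  rw [e]
  exact (h.integrable_mFourier_smul k).integral_prod_left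

/-- Joint measurability of the products `bⱼ w` (distorted class). [cite: DiPernaLions1989, §II.1 (12)–(14)] -/
theorem aestronglyMeasurable_carrier_smul (h : IsWeakTensorPassiveVectorDistortedOn A T 𝔸 b G w₀ w) (j : d) :
    AEStronglyMeasurable (fun p : ℝ × UnitAddTorus d => b p.1 p.2 j • w p.1 p.2)
      (((volume : Measure ℝ).restrict (Ioo 0 T)).prod volume) :=
  ((EuclideanSpace.proj j).continuous.comp_aestronglyMeasurable h.aestronglyMeasurable_uncurry_carrier).smul
    h.aestronglyMeasurable_uncurry

/-- Joint measurability of the products `wⱼ b` (distorted class). [cite: DiPernaLions1989, §II.1 (12)–(14)] -/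
theorem aestronglyMeasurable_smul_carrier (h : IsWeakTensorPassiveVectorDistortedOn A T 𝔸 b G w₀ w) (j : d) :
    AEStronglyMeasurable (fun p : ℝ × UnitAddTorus d => w p.1 p.2 j • b p.1 p.2)
      (((volume : Measure ℝ).restrict (Ioo 0 T)).prod volume) :=
  ((EuclideanSpace.proj j).continuous.comp_aestronglyMeasurable h.aestronglyMeasurable_uncurry).smul
    h.aestronglyMeasurable_uncurry_carrier

/-- `bⱼ w ∈ L¹((0,T) × T^d)` (distorted class). [cite: DiPernaLions1989, §II.1 (12)–(14)] -/
theorem integrable_carrier_smul (h : IsWeakTensorPassiveVectorDistortedOn A T 𝔸 b G w₀ w) (j : d) :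
    Integrable (fun p : ℝ × UnitAddTorus d => b p.1 p.2 j • w p.1 p.2)
      (((volume : Measure ℝ).restrict (Ioo 0 T)).prod volume) := by
  refine Integrable.mono' h.integrable_norm_carrier_mul_norm (h.aestronglyMeasurable_carrier_smul j)
    (Eventually.of_forall fun p => ?_)
  rw [norm_smul]
  exact mul_le_mul_of_nonneg_right
    (by simpa [Real.norm_eq_abs] using FunctionSpaces.Torus.abs_apply_le_norm (b p.1 p.2) j) (norm_nonneg _)

/-- `wⱼ b ∈ L¹((0,T) × T^d)` (distorted class). [cite: DiPernaLions1989, §II.1 (12)–(14)] -/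
theorem integrable_smul_carrier (h : IsWeakTensorPassiveVectorDistortedOn A T 𝔸 b G w₀ w) (j : d) :
    Integrable (fun p : ℝ × UnitAddTorus d => w p.1 p.2 j • b p.1 p.2)
      (((volume : Measure ℝ).restrict (Ioo 0 T)).prod volume) := by
  refine Integrable.mono' h.integrable_norm_carrier_mul_norm (h.aestronglyMeasurable_smul_carrier j)
    (Eventually.of_forall fun p => ?_)
  rw [norm_smul, mul_comm]
  exact mul_le_mul_of_nonneg_left
    (by simpa [Real.norm_eq_abs] using FunctionSpaces.Torus.abs_apply_le_norm (w p.1 p.2) j) (norm_nonneg _)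

/-- Integrability on `(0,T) × T^d` of `e_{-k} • complexify (bⱼ w)` (distorted class).
[cite: DiPernaLions1989, §II.1 (12)–(14)] -/
theorem integrable_mFourier_smul_carrier_smul (h : IsWeakTensorPassiveVectorDistortedOn A T 𝔸 b G w₀ w) (j : d)
    (k : d → ℤ) :
    Integrable (fun p : ℝ × UnitAddTorus d =>
      mFourier (-k) p.2 • FunctionSpaces.EuclideanSpace.complexify (b p.1 p.2 j • w p.1 p.2))
      (((volume : Measure ℝ).restrict (Ioo 0 T)).prod volume) :=
  ((FunctionSpaces.EuclideanSpace.complexify (ι := d)).toContinuousLinearMap.integrable_comp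
    (h.integrable_carrier_smul j)).bdd_smul 1
    ((mFourier (-k)).continuous.comp continuous_snd).aestronglyMeasurable
    (Eventually.of_forall fun p => ((mFourier (-k)).norm_coe_le_norm p.2).trans_eq mFourier_norm)

/-- Integrability on `(0,T) × T^d` of `e_{-k} • complexify (wⱼ b)` (distorted class).
[cite: DiPernaLions1989, §II.1 (12)–(14)] -/
theorem integrable_mFourier_smul_smul_carrier (h : IsWeakTensorPassiveVectorDistortedOn A T 𝔸 b G w₀ w) (j : d)
    (k : d → ℤ) :
    Integrable (fun p : ℝ × UnitAddTorus d =>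
      mFourier (-k) p.2 • FunctionSpaces.EuclideanSpace.complexify (w p.1 p.2 j • b p.1 p.2))
      (((volume : Measure ℝ).restrict (Ioo 0 T)).prod volume) :=
  ((FunctionSpaces.EuclideanSpace.complexify (ι := d)).toContinuousLinearMap.integrable_comp
    (h.integrable_smul_carrier j)).bdd_smul 1
    ((mFourier (-k)).continuous.comp continuous_snd).aestronglyMeasurable
    (Eventually.of_forall fun p => ((mFourier (-k)).norm_coe_le_norm p.2).trans_eq mFourier_norm)

/-- The modes `t ↦ 𝓕(bⱼ w)(t)(k)` are integrable on `(0,T)` (distorted class).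
[cite: DiPernaLions1989, §II.1 (12)–(14)] -/
theorem integrableOn_mFourierCoeff_carrier_smul (h : IsWeakTensorPassiveVectorDistortedOn A T 𝔸 b G w₀ w) (j : d)
    (k : d → ℤ) :
    Integrable (fun t => mFourierCoeff
        (FunctionSpaces.EuclideanSpace.complexify ∘ fun x => b t x j • w t x) k)
      (volume.restrict (Ioo 0 T)) := by
  have e : (fun t => mFourierCoeff
        (FunctionSpaces.EuclideanSpace.complexify ∘ fun x => b t x j • w t x) k) =
      fun t => ∫ x, mFourier (-k) x • FunctionSpaces.EuclideanSpace.complexify (b t x j • w t x) := by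
    funext t
    rw [FunctionSpaces.Torus.mFourierCoeff_eq_integral_volume]
    rfl
  rw [e]
  exact (h.integrable_mFourier_smul_carrier_smul j k).integral_prod_left

/-- The modes `t ↦ 𝓕(wⱼ b)(t)(k)` are integrable on `(0,T)` (distorted class).
[cite: DiPernaLions1989, §II.1 (12)–(14)] -/
theorem integrableOn_mFourierCoeff_smul_carrier (h : IsWeakTensorPassiveVectorDistortedOn A T 𝔸 b G w₀ w) (j : d)
    (k : d → ℤ) :
    Integrable (fun t => mFourierCoeff
        (FunctionSpaces.EuclideanSpace.complexify ∘ fun x => w t x j • b t x) k)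
      (volume.restrict (Ioo 0 T)) := by
  have e : (fun t => mFourierCoeff
        (FunctionSpaces.EuclideanSpace.complexify ∘ fun x => w t x j • b t x) k) =
      fun t => ∫ x, mFourier (-k) x • FunctionSpaces.EuclideanSpace.complexify (w t x j • b t x) := by
    funext t
    rw [FunctionSpaces.Torus.mFourierCoeff_eq_integral_volume]
    rfl
  rw [e]
  exact (h.integrable_mFourier_smul_smul_carrier j k).integral_prod_left

/-- For a.e. `t ∈ (0,T)`: the slice `w t` and all the products `bⱼ(t) w(t)`, `wⱼ(t) b(t)` are
integrable on `T^d` (distorted class). [cite: DiPernaLions1989, §II.1 (12)–(14)] -/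
theorem ae_integrable_slice (h : IsWeakTensorPassiveVectorDistortedOn A T 𝔸 b G w₀ w) :
    ∀ᵐ t ∂(volume.restrict (Ioo 0 T)),
      Integrable (w t) volume ∧ (∀ j, Integrable (fun x => b t x j • w t x) volume) ∧
        (∀ j, Integrable (fun x => w t x j • b t x) volume) := by
  have h1 : ∀ᵐ t ∂(volume.restrict (Ioo 0 T)), ∀ j, Integrable (fun x => b t x j • w t x) volume :=
    ae_all_iff.2 fun j => (h.integrable_carrier_smul j).prod_right_ae
  have h2 : ∀ᵐ t ∂(volume.restrict (Ioo 0 T)), ∀ j, Integrable (fun x => w t x j • b t x) volume :=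
    ae_all_iff.2 fun j => (h.integrable_smul_carrier j).prod_right_ae
  filter_upwards [h.ae_memLp_two, h1, h2] with t ht h1t h2t
  exact ⟨ht.integrable one_le_two, h1t, h2t⟩

/-- Integrability on `(0,T)` of the modewise right-hand side with an arbitrary symbol tensor `𝔹`
`−4π² ⟪ŵ(τ)(k), T_𝔹(k) z⟫ + (∑ⱼ 2πi kⱼ ⟪𝓕(bⱼ w)(τ)(k), z⟫ + A ∑ⱼ 2πi kⱼ ⟪𝓕(wⱼ b)(τ)(k), z⟫)`
(distorted class; used with `𝔹 = 𝔸^{G₀}`). [cite: DiPernaLions1989, §II.1 (12)–(14)] -/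
theorem integrableOn_modeRHS (h : IsWeakTensorPassiveVectorDistortedOn A T 𝔸 b G w₀ w) (𝔹 : Visc4 d) (k : d → ℤ)
    (z : EuclideanSpace ℂ d) :
    Integrable (fun τ =>
      (-(4 * Real.pi ^ 2 : ℝ) : ℂ) *
          ⟪mFourierCoeff (FunctionSpaces.EuclideanSpace.complexify ∘ w τ) k, symbT 𝔹 k z⟫_ℂ +
        ((∑ j, (2 * Real.pi * I * (k j)) *
            ⟪mFourierCoeff (FunctionSpaces.EuclideanSpace.complexify ∘ fun x => b τ x j • w τ x) k, z⟫_ℂ) +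
          (A : ℂ) * ∑ j, (2 * Real.pi * I * (k j)) *
            ⟪mFourierCoeff (FunctionSpaces.EuclideanSpace.complexify ∘ fun x => w τ x j • b τ x) k, z⟫_ℂ))
      (volume.restrict (Ioo 0 T)) :=
  (((h.integrableOn_mFourierCoeff k).inner_const (symbT 𝔹 k z)).const_mul _).add
    ((integrable_finsetSum _ fun j _ => ((h.integrableOn_mFourierCoeff_carrier_smul j k).inner_const z).const_mul _).add
      ((integrable_finsetSum _ fun j _ =>
        ((h.integrableOn_mFourierCoeff_smul_carrier j k).inner_const z).const_mul _).const_mul _))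

end IsWeakTensorPassiveVectorDistortedOn

end ModeIntegrability

/-! ## §2 Constant frame: the weak formulation against steady fields -/

section ConstFrame

namespace IsWeakTensorPassiveVectorDistortedOn

variable {A T : ℝ} {𝔸 : Visc4 d} {b w : ℝ → UnitAddTorus d → EuclideanSpace ℝ d}
  {G₀ : Matrix d d ℝ} {w₀ : UnitAddTorus d → EuclideanSpace ℝ d}

/-- **The constant-frame weak formulation tested with `η(t) • Γ(y)`.** For a distorted weak solution with
the CONSTANT frame `G ≡ G₀`, a smooth compactly supported `η` with `tsupport η ⊆ (-∞, T)` and a steady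
smooth field `Γ : T^d → ℝ^d` with `∇·(G₀ Γ) = 0`:
`∫_{(0,T)} (η'(t) ∫⟪w(t), Γ⟫ + η(t) (∫⟪w(t), (b(t)·∇)Γ + 𝓛_{𝔸^{G₀}}^*Γ⟫ + A ∫⟪b(t), (w(t)·∇)Γ⟫)) dt + η(0) ∫⟪w₀, Γ⟫ = 0`
— verbatim the flat identity `IsWeakTensorPassiveVectorOn.setIntegral_test_smul` for the conjugated
tensor `𝔸^{G₀} = Visc4.conj G₀ 𝔸` (`viscAdjVar_const`), the divergence constraint on the test being the
twisted one. [cite: Temam1984, Ch. III §1.1] [cite: ArmstrongVicol2025, §4.1 (PDF p. 34)] -/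
theorem setIntegral_test_smul_constFrame
    (h : IsWeakTensorPassiveVectorDistortedOn A T 𝔸 b (fun _ _ => G₀) w₀ w) {η : ℝ → ℝ}
    (hη : ContDiff ℝ ∞ η) (hηc : HasCompactSupport η) (hηT : tsupport η ⊆ Iio T)
    {Γ : UnitAddTorus d → EuclideanSpace ℝ d} (hΓ : FunctionSpaces.Torus.IsSmooth Γ)
    (hΓdiv : FunctionSpaces.Torus.IsDivFree (distort (fun _ => G₀) Γ)) :
    (∫ t in Ioo 0 T, ((deriv η t * ∫ x, ⟪w t x, Γ x⟫_ℝ) +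
      η t * ((∫ x, ⟪w t x, FunctionSpaces.Torus.convect (b t) Γ x + viscAdj (Visc4.conj G₀ 𝔸) Γ x⟫_ℝ) +
        A * ∫ x, ⟪b t x, FunctionSpaces.Torus.convect (w t) Γ x⟫_ℝ))) +
      η 0 * ∫ x, ⟪w₀ x, Γ x⟫_ℝ = 0 := by
  have hΓ1 : FunctionSpaces.Torus.IsContDiff 1 Γ := hΓ.isContDiff (by simp)
  -- the steady field as a (trivially) time-Lipschitz space-smooth field
  have hψs : ∀ t : ℝ, FunctionSpaces.Torus.IsSmooth ((fun (_ : ℝ) => Γ) t) := fun _ => hΓ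
  have hψc : ∀ l : List d, Continuous (uncurry fun (t : ℝ) y =>
      FunctionSpaces.Torus.iterPartialDeriv l ((fun (_ : ℝ) => Γ) t) y) := fun l =>
    (hΓ.iterPartialDeriv l).continuous.comp continuous_snd
  have hψL : ∃ L : ℝ, 0 ≤ L ∧ ∀ t ∈ Icc 0 T, ∀ s ∈ Icc 0 T, ∀ y,
      ‖(fun (_ : ℝ) => Γ) t y - (fun (_ : ℝ) => Γ) s y‖ ≤ L * |t - s| :=
    ⟨0, le_rfl, fun t _ s _ y => by simp⟩
  have hψdiv : ∀ t : ℝ, FunctionSpaces.Torus.IsDivFree (distort ((fun (_ : ℝ) (_ : UnitAddTorus d) => G₀) t)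
      ((fun (_ : ℝ) => Γ) t)) := fun _ => hΓdiv
  have hψ' : ∀ᵐ t ∂(volume.restrict (Ioo 0 T)), ∀ y,
      HasDerivAt (fun s => (fun (_ : ℝ) => Γ) s y) ((fun (_ : ℝ) (_ : UnitAddTorus d) => (0 : EuclideanSpace ℝ d)) t y) t :=
    Eventually.of_forall fun t y => hasDerivAt_const t (Γ y)
  -- the constant-frame viscous test operator is the flat one of the conjugated tensor
  have hvisc : ∀ x, viscAdjVar (fun (_ : UnitAddTorus d) => Visc4.conj G₀ 𝔸) Γ x =
      viscAdj (Visc4.conj G₀ 𝔸) Γ x := fun x => viscAdjVar_const (Visc4.conj G₀ 𝔸) hΓ x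
  have hpt : ∀ p : ℝ × UnitAddTorus d,
      ⟪w p.1 p.2, (fun (_ : ℝ) (_ : UnitAddTorus d) => (0 : EuclideanSpace ℝ d)) p.1 p.2 +
          FunctionSpaces.Torus.convect (b p.1) ((fun (_ : ℝ) => Γ) p.1) p.2 +
          viscAdjVar (fun y => Visc4.conj ((fun (_ : ℝ) (_ : UnitAddTorus d) => G₀) p.1 y) 𝔸) ((fun (_ : ℝ) => Γ) p.1) p.2⟫_ℝ +
        A * ⟪b p.1 p.2, FunctionSpaces.Torus.convect (w p.1) ((fun (_ : ℝ) => Γ) p.1) p.2⟫_ℝ =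
      ⟪w p.1 p.2, FunctionSpaces.Torus.convect (b p.1) Γ p.2⟫_ℝ + ⟪w p.1 p.2, viscAdj (Visc4.conj G₀ 𝔸) Γ p.2⟫_ℝ +
        A * ⟪b p.1 p.2, FunctionSpaces.Torus.convect (w p.1) Γ p.2⟫_ℝ := by
    intro p
    simp only
    rw [zero_add, inner_add_right, hvisc]
  -- integrability of the space–time integrand (`hint`)
  have hΓd : ∀ j, Continuous (uncurry fun (_ : ℝ) (x : UnitAddTorus d) => FunctionSpaces.Torus.partialDeriv j Γ x) :=
    fun j => (hΓ.partialDeriv j).continuous.comp continuous_snd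
  have hVl : Continuous (uncurry fun (_ : ℝ) (x : UnitAddTorus d) => viscAdj (Visc4.conj G₀ 𝔸) Γ x) :=
    (isSmooth_viscAdj (Visc4.conj G₀ 𝔸) hΓ).continuous.comp continuous_snd
  have hint : Integrable (fun p : ℝ × UnitAddTorus d =>
      ⟪w p.1 p.2, (fun (_ : ℝ) (_ : UnitAddTorus d) => (0 : EuclideanSpace ℝ d)) p.1 p.2 +
          FunctionSpaces.Torus.convect (b p.1) ((fun (_ : ℝ) => Γ) p.1) p.2 +
          viscAdjVar (fun y => Visc4.conj ((fun (_ : ℝ) (_ : UnitAddTorus d) => G₀) p.1 y) 𝔸) ((fun (_ : ℝ) => Γ) p.1) p.2⟫_ℝ +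
        A * ⟪b p.1 p.2, FunctionSpaces.Torus.convect (w p.1) ((fun (_ : ℝ) => Γ) p.1) p.2⟫_ℝ)
      (((volume : Measure ℝ).restrict (Ioo 0 T)).prod volume) := by
    refine Integrable.congr ?_ (Eventually.of_forall fun p => (hpt p).symm)
    exact ((h.integrable_inner_convect (Φ := fun _ => Γ) (fun _ => hΓ1) hΓd).add
      (h.integrable_inner_of_continuous (Φ := fun _ x => viscAdj (Visc4.conj G₀ 𝔸) Γ x) hVl)).add
      ((h.integrable_inner_carrier_convect (Φ := fun _ => Γ) (fun _ => hΓ1) hΓd).const_mul A)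
  have key := h.setIntegral_test_smul_lipschitzField (ψ := fun _ => Γ) (ψ' := fun _ _ => 0)
    hψs hψc hψL hψdiv hψ' hint hη hηc hηT
  -- rewrite the slice integrals
  have hsl : ∀ t, (∫ x, (⟪w t x, 0 + FunctionSpaces.Torus.convect (b t) Γ x +
          viscAdjVar (fun (_ : UnitAddTorus d) => Visc4.conj G₀ 𝔸) Γ x⟫_ℝ +
        A * ⟪b t x, FunctionSpaces.Torus.convect (w t) Γ x⟫_ℝ)) =
      ∫ x, (⟪w t x, FunctionSpaces.Torus.convect (b t) Γ x + viscAdj (Visc4.conj G₀ 𝔸) Γ x⟫_ℝ +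
        A * ⟪b t x, FunctionSpaces.Torus.convect (w t) Γ x⟫_ℝ) := by
    intro t
    refine integral_congr_ae (Eventually.of_forall fun x => ?_)
    simp only [zero_add, hvisc]
  simp_rw [hsl] at key
  -- split `∫ (f + A g)` slice by slice where integrable (a.e. `t`), inside the `t`-integral
  have hIc : Integrable (fun p : ℝ × UnitAddTorus d =>
      ⟪w p.1 p.2, FunctionSpaces.Torus.convect (b p.1) Γ p.2 + viscAdj (Visc4.conj G₀ 𝔸) Γ p.2⟫_ℝ)
      (((volume : Measure ℝ).restrict (Ioo 0 T)).prod volume) := by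
    refine ((h.integrable_inner_convect (Φ := fun _ => Γ) (fun _ => hΓ1) hΓd).add
      (h.integrable_inner_of_continuous (Φ := fun _ x => viscAdj (Visc4.conj G₀ 𝔸) Γ x) hVl)).congr
      (Eventually.of_forall fun p => ?_)
    simp only [Pi.add_apply]
    rw [inner_add_right]
  have hI₃ : Integrable (fun p : ℝ × UnitAddTorus d => A * ⟪b p.1 p.2, FunctionSpaces.Torus.convect (w p.1) Γ p.2⟫_ℝ)
      (((volume : Measure ℝ).restrict (Ioo 0 T)).prod volume) :=
    (h.integrable_inner_carrier_convect (Φ := fun _ => Γ) (fun _ => hΓ1) hΓd).const_mul A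
  have hae : ∀ᵐ t ∂(volume.restrict (Ioo 0 T)),
      (deriv η t * ∫ x, ⟪w t x, Γ x⟫_ℝ) +
        η t * ∫ x, (⟪w t x, FunctionSpaces.Torus.convect (b t) Γ x + viscAdj (Visc4.conj G₀ 𝔸) Γ x⟫_ℝ +
          A * ⟪b t x, FunctionSpaces.Torus.convect (w t) Γ x⟫_ℝ) =
      (deriv η t * ∫ x, ⟪w t x, Γ x⟫_ℝ) +
        η t * ((∫ x, ⟪w t x, FunctionSpaces.Torus.convect (b t) Γ x + viscAdj (Visc4.conj G₀ 𝔸) Γ x⟫_ℝ) +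
          A * ∫ x, ⟪b t x, FunctionSpaces.Torus.convect (w t) Γ x⟫_ℝ) := by
    filter_upwards [hIc.prod_right_ae, hI₃.prod_right_ae] with t h1 h2
    rw [integral_add h1 h2, integral_const_mul]
  rw [integral_congr_ae hae] at key
  exact key

/-- **The constant-frame steady-field pairing identity** (a.e. du Bois-Reymond form): for a distorted
weak solution with constant frame `G ≡ G₀` and a steady smooth field `Γ` with `∇·(G₀ Γ) = 0`, for a.e.
`t ∈ (0,T)`,
`∫⟪w(t), Γ⟫ = ∫⟪w₀, Γ⟫ + ∫_{(0,t]} (∫⟪w(τ), (b(τ)·∇)Γ + 𝓛_{𝔸^{G₀}}^*Γ⟫ + A ∫⟪b(τ), (w(τ)·∇)Γ⟫) dτ`.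
[cite: Temam1984, Ch. III §1.1] [cite: DiPernaLions1989, §II.1 (13)–(14)] -/
theorem ae_integral_inner_eq_constFrame
    (h : IsWeakTensorPassiveVectorDistortedOn A T 𝔸 b (fun _ _ => G₀) w₀ w)
    {Γ : UnitAddTorus d → EuclideanSpace ℝ d} (hΓ : FunctionSpaces.Torus.IsSmooth Γ)
    (hΓdiv : FunctionSpaces.Torus.IsDivFree (distort (fun _ => G₀) Γ)) :
    ∀ᵐ t ∂(volume.restrict (Ioo 0 T)),
      ∫ x, ⟪w t x, Γ x⟫_ℝ = (∫ x, ⟪w₀ x, Γ x⟫_ℝ) +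
        ∫ τ in Ioc 0 t, ((∫ x, ⟪w τ x, FunctionSpaces.Torus.convect (b τ) Γ x + viscAdj (Visc4.conj G₀ 𝔸) Γ x⟫_ℝ) +
          A * ∫ x, ⟪b τ x, FunctionSpaces.Torus.convect (w τ) Γ x⟫_ℝ) := by
  have hΓ1 : FunctionSpaces.Torus.IsContDiff 1 Γ := hΓ.isContDiff (by simp)
  have hΓc : Continuous (uncurry fun (_ : ℝ) (x : UnitAddTorus d) => Γ x) := hΓ.continuous.comp continuous_snd
  have hΓd : ∀ j, Continuous (uncurry fun (_ : ℝ) (x : UnitAddTorus d) => FunctionSpaces.Torus.partialDeriv j Γ x) :=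
    fun j => (hΓ.partialDeriv j).continuous.comp continuous_snd
  have hVl : Continuous (uncurry fun (_ : ℝ) (x : UnitAddTorus d) => viscAdj (Visc4.conj G₀ 𝔸) Γ x) :=
    (isSmooth_viscAdj (Visc4.conj G₀ 𝔸) hΓ).continuous.comp continuous_snd
  have hU : IntegrableOn (fun t => ∫ x, ⟪w t x, Γ x⟫_ℝ) (Ioo 0 T) volume :=
    (h.integrable_inner_of_continuous hΓc).integral_prod_left
  have hIc : Integrable (fun p : ℝ × UnitAddTorus d =>
      ⟪w p.1 p.2, FunctionSpaces.Torus.convect (b p.1) Γ p.2 + viscAdj (Visc4.conj G₀ 𝔸) Γ p.2⟫_ℝ)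
      (((volume : Measure ℝ).restrict (Ioo 0 T)).prod volume) := by
    refine ((h.integrable_inner_convect (Φ := fun _ => Γ) (fun _ => hΓ1) hΓd).add
      (h.integrable_inner_of_continuous (Φ := fun _ x => viscAdj (Visc4.conj G₀ 𝔸) Γ x) hVl)).congr
      (Eventually.of_forall fun p => ?_)
    simp only [Pi.add_apply]
    rw [inner_add_right]
  have hI₃ : Integrable (fun p : ℝ × UnitAddTorus d => A * ⟪b p.1 p.2, FunctionSpaces.Torus.convect (w p.1) Γ p.2⟫_ℝ)
      (((volume : Measure ℝ).restrict (Ioo 0 T)).prod volume) :=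
    (h.integrable_inner_carrier_convect (Φ := fun _ => Γ) (fun _ => hΓ1) hΓd).const_mul A
  have hF : IntegrableOn (fun t =>
      (∫ x, ⟪w t x, FunctionSpaces.Torus.convect (b t) Γ x + viscAdj (Visc4.conj G₀ 𝔸) Γ x⟫_ℝ) +
        A * ∫ x, ⟪b t x, FunctionSpaces.Torus.convect (w t) Γ x⟫_ℝ) (Ioo 0 T) volume := by
    refine (hIc.integral_prod_left.add hI₃.integral_prod_left).congr (Eventually.of_forall fun t => ?_)
    simp only [Pi.add_apply]
    rw [integral_const_mul]
  exact FunctionSpaces.ae_eq_add_setIntegral_of_forall_test hU hF fun η hη hηc hηT =>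
    h.setIntegral_test_smul_constFrame hη hηc hηT hΓ hΓdiv

end IsWeakTensorPassiveVectorDistortedOn

end ConstFrame

/-! ## §3 A single real mode under a constant distortion -/

section SingleMode

/-- Coordinates of the complexified action of a real matrix on `ℂ^d`:
`(G₀ • z)_a = Σ_b G₀ab z_b` (`G₀ • z := Matrix.toEuclideanCLM (G₀.map ofReal) z`; Mathlib plumbing, the
coordinates of `Matrix.mulVec`). [cite: ArmstrongVicol2025, §4.1 (PDF p. 34)] -/
theorem toEuclideanCLM_map_ofReal_apply (G₀ : Matrix d d ℝ) (z : EuclideanSpace ℂ d) (a : d) :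
    Matrix.toEuclideanCLM (n := d) (𝕜 := ℂ) (G₀.map Complex.ofReal) z a = ∑ b', ((G₀ a b' : ℝ) : ℂ) * z b' := by
  rw [show Matrix.toEuclideanCLM (n := d) (𝕜 := ℂ) (G₀.map Complex.ofReal) z a =
    WithLp.ofLp (Matrix.toEuclideanCLM (n := d) (𝕜 := ℂ) (G₀.map Complex.ofReal) z) a from rfl,
    Matrix.ofLp_toEuclideanCLM]
  simp [Matrix.mulVec, dotProduct, Matrix.map_apply]

/-- **A constant real matrix acts on a single real mode coefficientwise**:
`G₀ • Re(e_k • z) = Re(e_k • G₀z)`, i.e. `distort (fun _ => G₀) (realTrigPoly S c) = realTrigPoly S (G₀ • c)`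
with `(G₀ • c) k = Matrix.toEuclideanCLM (G₀.map ofReal) (c k)` (the frozen-frame pull-back of a plane wave
is a plane wave). [cite: ArmstrongVicol2025, §4.1 (PDF p. 34)] -/
theorem distort_const_realTrigPoly (G₀ : Matrix d d ℝ) (S : Finset (d → ℤ)) (c : (d → ℤ) → EuclideanSpace ℂ d) :
    distort (fun _ => G₀) (FunctionSpaces.Torus.realTrigPoly S c) =
      FunctionSpaces.Torus.realTrigPoly S
        (fun k => Matrix.toEuclideanCLM (n := d) (𝕜 := ℂ) (G₀.map Complex.ofReal) (c k)) := by
  funext y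
  ext a
  rw [distort_apply]
  simp only [FunctionSpaces.Torus.realTrigPoly_apply_coord, FunctionSpaces.Torus.trigPoly_apply_coord,
    toEuclideanCLM_map_ofReal_apply]
  have lhs : ∑ b', G₀ a b' * (∑ k ∈ S, mFourier k y * c k b').re =
      (∑ b', ((G₀ a b' : ℝ) : ℂ) * ∑ k ∈ S, mFourier k y * c k b').re := by
    rw [Complex.re_sum]
    exact Finset.sum_congr rfl fun b' _ => by rw [Complex.re_ofReal_mul]
  rw [lhs]
  congr 1
  simp_rw [Finset.mul_sum]
  rw [Finset.sum_comm]
  exact Finset.sum_congr rfl fun k _ => Finset.sum_congr rfl fun b' _ => by ring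

omit [DecidableEq d] in
/-- The twisted frequency in coordinates: `(G₀ᵀk)_b = ((k : ℝ^d) ᵥ* G₀)_b = Σ_a k_a G₀ab` (cast to `ℂ`;
Mathlib plumbing, the coordinates of `Matrix.vecMul`). [cite: ArmstrongVicol2025, §4.1 (PDF p. 34)] -/
theorem ofReal_vecMul_intCast_apply (G₀ : Matrix d d ℝ) (k : d → ℤ) (b' : d) :
    ((Matrix.vecMul (fun a => (k a : ℝ)) G₀ b' : ℝ) : ℂ) = ∑ a, (k a : ℂ) * ((G₀ a b' : ℝ) : ℂ) := by
  simp only [Matrix.vecMul, dotProduct]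
  push_cast
  rfl

/-- **Admissible single-mode steady tests for the constant frame**: if `z` is transversal to the
TWISTED frequency `G₀ᵀk` (`Σ_b (Σ_a k_a G₀ab) z_b = 0`), then `∇·(G₀ Re(e_k • z)) = 0` (the Lagrangian
solenoidality constraint `∇·(G w) = 0` of a frozen frame on plane waves; for `G₀ = 1` it is
Robinson–Rodrigo–Sadowski's `k · û_k = 0`). [cite: ArmstrongVicol2025, §4.1 (PDF p. 34)]
[cite: RobinsonRodrigoSadowski2016, Def. 2.1 p. 42] -/
theorem isDivFree_distort_const_realTrigPoly_singleton (G₀ : Matrix d d ℝ) {k : d → ℤ}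
    {c : (d → ℤ) → EuclideanSpace ℂ d}
    (hz : ∑ b', ((Matrix.vecMul (fun a => (k a : ℝ)) G₀ b' : ℝ) : ℂ) * c k b' = 0) :
    FunctionSpaces.Torus.IsDivFree (distort (fun _ => G₀) (FunctionSpaces.Torus.realTrigPoly {k} c)) := by
  rw [distort_const_realTrigPoly]
  refine FunctionSpaces.Torus.isDivFree_realTrigPoly_singleton ?_
  simp_rw [toEuclideanCLM_map_ofReal_apply, Finset.mul_sum]
  rw [Finset.sum_comm, ← hz]
  refine Finset.sum_congr rfl fun b' _ => ?_
  rw [ofReal_vecMul_intCast_apply, Finset.sum_mul]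
  exact Finset.sum_congr rfl fun a _ => by ring

end SingleMode

/-! ## §4 The constant-frame modewise integral identity -/

section ModeIdentity

namespace IsWeakTensorPassiveVectorDistortedOn

variable {A T : ℝ} {𝔸 : Visc4 d} {b w : ℝ → UnitAddTorus d → EuclideanSpace ℝ d}
  {G₀ : Matrix d d ℝ} {w₀ : UnitAddTorus d → EuclideanSpace ℝ d}

/-- **The constant-frame modewise integral identity, tested (real) form.** For every `k ∈ ℤ^d` and every
coefficient family `c` transversal to the twisted frequency at `k` (`(G₀ᵀk) · c k = 0`), for a.e. `t ∈ (0,T)`,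
`Re ⟪ŵ(t)(k), c k⟫ = Re ⟪ŵ₀(k), c k⟫ + ∫_{(0,t]} Re (−4π² ⟪ŵ(τ)(k), T_{𝔸^{G₀}}(k) c k⟫
  + ∑ⱼ 2πi kⱼ ⟪𝓕(bⱼ w)(τ)(k), c k⟫ + A ∑ⱼ 2πi kⱼ ⟪𝓕(wⱼ b)(τ)(k), c k⟫) dτ`
(the constant-frame weak formulation tested with `η(t) Re (e_k(x) • c k)` and the a.e. du Bois-Reymond
lemma with datum). [cite: Temam1984, Ch. III §1.1] [cite: ArmstrongVicol2025, §4.1 (PDF p. 34)] -/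
theorem ae_re_inner_mFourierCoeff_eq_constFrame
    (h : IsWeakTensorPassiveVectorDistortedOn A T 𝔸 b (fun _ _ => G₀) w₀ w)
    (hw₀ : Integrable w₀ volume) (k : d → ℤ) {c : (d → ℤ) → EuclideanSpace ℂ d}
    (hz : ∑ b', ((Matrix.vecMul (fun a => (k a : ℝ)) G₀ b' : ℝ) : ℂ) * c k b' = 0) :
    ∀ᵐ t ∂(volume.restrict (Ioo 0 T)),
      (⟪mFourierCoeff (FunctionSpaces.EuclideanSpace.complexify ∘ w t) k, c k⟫_ℂ).re =
        (⟪mFourierCoeff (FunctionSpaces.EuclideanSpace.complexify ∘ w₀) k, c k⟫_ℂ).re +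
        ∫ τ in Ioc 0 t,
          ((-(4 * Real.pi ^ 2 : ℝ) : ℂ) *
              ⟪mFourierCoeff (FunctionSpaces.EuclideanSpace.complexify ∘ w τ) k, symbT (Visc4.conj G₀ 𝔸) k (c k)⟫_ℂ +
            ((∑ j, (2 * Real.pi * I * (k j)) *
                ⟪mFourierCoeff (FunctionSpaces.EuclideanSpace.complexify ∘ fun x => b τ x j • w τ x) k, c k⟫_ℂ) +
              (A : ℂ) * ∑ j, (2 * Real.pi * I * (k j)) *
                ⟪mFourierCoeff (FunctionSpaces.EuclideanSpace.complexify ∘ fun x => w τ x j • b τ x) k, c k⟫_ℂ)).re := by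
  have hAi : Integrable (fun t => ⟪mFourierCoeff (FunctionSpaces.EuclideanSpace.complexify ∘ w t) k, c k⟫_ℂ)
      (volume.restrict (Ioo 0 T)) := (h.integrableOn_mFourierCoeff k).inner_const (c k)
  have hBi := h.integrableOn_modeRHS (Visc4.conj G₀ 𝔸) k (c k)
  refine FunctionSpaces.ae_eq_add_setIntegral_of_forall_test hAi.re hBi.re fun η hη hηc hηT => ?_
  have key := h.setIntegral_test_smul_constFrame hη hηc hηT (FunctionSpaces.Torus.isSmooth_realTrigPoly {k} c)
    (isDivFree_distort_const_realTrigPoly_singleton G₀ hz)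
  rw [FunctionSpaces.Torus.integral_inner_realTrigPoly_singleton hw₀ k c] at key
  have hae : ∀ᵐ τ ∂(volume.restrict (Ioo 0 T)),
      (deriv η τ * ∫ x, ⟪w τ x, FunctionSpaces.Torus.realTrigPoly {k} c x⟫_ℝ) +
        η τ * ((∫ x, ⟪w τ x, FunctionSpaces.Torus.convect (b τ) (FunctionSpaces.Torus.realTrigPoly {k} c) x +
            viscAdj (Visc4.conj G₀ 𝔸) (FunctionSpaces.Torus.realTrigPoly {k} c) x⟫_ℝ) +
          A * ∫ x, ⟪b τ x, FunctionSpaces.Torus.convect (w τ) (FunctionSpaces.Torus.realTrigPoly {k} c) x⟫_ℝ) =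
      deriv η τ * (⟪mFourierCoeff (FunctionSpaces.EuclideanSpace.complexify ∘ w τ) k, c k⟫_ℂ).re +
        η τ * ((-(4 * Real.pi ^ 2 : ℝ) : ℂ) *
              ⟪mFourierCoeff (FunctionSpaces.EuclideanSpace.complexify ∘ w τ) k, symbT (Visc4.conj G₀ 𝔸) k (c k)⟫_ℂ +
            ((∑ j, (2 * Real.pi * I * (k j)) *
                ⟪mFourierCoeff (FunctionSpaces.EuclideanSpace.complexify ∘ fun x => b τ x j • w τ x) k, c k⟫_ℂ) +
              (A : ℂ) * ∑ j, (2 * Real.pi * I * (k j)) *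
                ⟪mFourierCoeff (FunctionSpaces.EuclideanSpace.complexify ∘ fun x => w τ x j • b τ x) k, c k⟫_ℂ)).re := by
    filter_upwards [h.ae_integrable_slice] with τ hτ
    rw [FunctionSpaces.Torus.integral_inner_realTrigPoly_singleton hτ.1 k c,
      integral_inner_convect_add_viscAdj_realTrigPoly_singleton hτ.1 hτ.2.1 (Visc4.conj G₀ 𝔸) k c,
      integral_inner_convect_realTrigPoly_singleton hτ.2.2 k c, ← Complex.re_ofReal_mul A, ← Complex.add_re,
      add_assoc]
  rw [integral_congr_ae hae] at key
  exact key

/-- **The Fourier modes of a constant-frame distorted weak solution solve the TWISTED Leray-projected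
mode equations in integrated form.** For a weak solution `w ∈ L^∞(0,T; L²(T^d))` of the `G₀`-distorted
problem `∂ₜw + (b·∇)w + A (w·∇)b + G₀ᵀ∇π = 𝓛^{G₀} w`, `∇·(G₀ w) = 0` (constant frame), with datum `w₀ ∈ L¹`,
every `k ∈ ℤ^d` and every `z ∈ ℂ^d` transversal to the twisted frequency `G₀ᵀk`
(`Σ_b (Σ_a k_a G₀ab) z_b = 0`): for a.e. `t ∈ (0,T)`,
`⟪ŵ(t)(k), z⟫ = ⟪ŵ₀(k), z⟫ + ∫_{(0,t]} (−4π² ⟪ŵ(τ)(k), T_{𝔸^{G₀}}(k) z⟫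
  + ∑ⱼ 2πi kⱼ ⟪𝓕(bⱼ w)(τ)(k), z⟫ + A ∑ⱼ 2πi kⱼ ⟪𝓕(wⱼ b)(τ)(k), z⟫) dτ`,
`𝔸^{G₀} = Visc4.conj G₀ 𝔸` — the flat identity `IsWeakTensorPassiveVectorOn.ae_inner_mFourierCoeff_eq`
with the constraint plane `k^⊥` replaced by `(G₀ᵀk)^⊥` and the symbol by that of the conjugated tensor.
[cite: DiPernaLions1989, §II.1 (13)–(14)] [cite: ArmstrongVicol2025, §4.1 (PDF p. 34)] -/
theorem ae_inner_mFourierCoeff_eq_constFrame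
    (h : IsWeakTensorPassiveVectorDistortedOn A T 𝔸 b (fun _ _ => G₀) w₀ w)
    (hw₀ : Integrable w₀ volume) (k : d → ℤ) {z : EuclideanSpace ℂ d}
    (hz : ∑ b', ((Matrix.vecMul (fun a => (k a : ℝ)) G₀ b' : ℝ) : ℂ) * z b' = 0) :
    ∀ᵐ t ∂(volume.restrict (Ioo 0 T)),
      ⟪mFourierCoeff (FunctionSpaces.EuclideanSpace.complexify ∘ w t) k, z⟫_ℂ =
        ⟪mFourierCoeff (FunctionSpaces.EuclideanSpace.complexify ∘ w₀) k, z⟫_ℂ +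
        ∫ τ in Ioc 0 t,
          ((-(4 * Real.pi ^ 2 : ℝ) : ℂ) *
              ⟪mFourierCoeff (FunctionSpaces.EuclideanSpace.complexify ∘ w τ) k, symbT (Visc4.conj G₀ 𝔸) k z⟫_ℂ +
            ((∑ j, (2 * Real.pi * I * (k j)) *
                ⟪mFourierCoeff (FunctionSpaces.EuclideanSpace.complexify ∘ fun x => b τ x j • w τ x) k, z⟫_ℂ) +
              (A : ℂ) * ∑ j, (2 * Real.pi * I * (k j)) *
                ⟪mFourierCoeff (FunctionSpaces.EuclideanSpace.complexify ∘ fun x => w τ x j • b τ x) k, z⟫_ℂ)) := by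
  have hBi := h.integrableOn_modeRHS (Visc4.conj G₀ 𝔸) k z
  -- the transversal families `z` and `i z`
  have hz' : ∑ b', ((Matrix.vecMul (fun a => (k a : ℝ)) G₀ b' : ℝ) : ℂ) * (fun _ : d → ℤ => I • z) k b' = 0 := by
    simp only [PiLp.smul_apply, smul_eq_mul]
    calc ∑ b', ((Matrix.vecMul (fun a => (k a : ℝ)) G₀ b' : ℝ) : ℂ) * (I * z b')
        = I * ∑ b', ((Matrix.vecMul (fun a => (k a : ℝ)) G₀ b' : ℝ) : ℂ) * z b' := by
          rw [Finset.mul_sum]; exact Finset.sum_congr rfl fun j _ => by ring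
      _ = 0 := by rw [hz, mul_zero]
  have h1 := h.ae_re_inner_mFourierCoeff_eq_constFrame hw₀ k (c := fun _ => z) hz
  have hI := h.ae_re_inner_mFourierCoeff_eq_constFrame hw₀ k (c := fun _ => I • z) hz'
  filter_upwards [h1, hI, ae_restrict_mem measurableSet_Ioo] with t h1 hI ht
  have hBt := (show IntegrableOn _ (Ioo 0 T) volume from hBi).mono_set (Ioc_subset_Ioo_right ht.2)
  -- pull the factor `i` out of every pairing
  have pull : ∀ (X : ℂ) (F F' : d → ℂ),
      (-(4 * Real.pi ^ 2 : ℝ) : ℂ) * (I * X) +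
        ((∑ j, (2 * Real.pi * I * (k j)) * (I * F j)) + (A : ℂ) * ∑ j, (2 * Real.pi * I * (k j)) * (I * F' j)) =
      I * ((-(4 * Real.pi ^ 2 : ℝ) : ℂ) * X +
        ((∑ j, (2 * Real.pi * I * (k j)) * F j) + (A : ℂ) * ∑ j, (2 * Real.pi * I * (k j)) * F' j)) := by
    intro X F F'
    have e1 : ∑ j, (2 * Real.pi * I * (k j)) * (I * F j) = I * ∑ j, (2 * Real.pi * I * (k j)) * F j := by
      rw [Finset.mul_sum]; exact Finset.sum_congr rfl fun j _ => by ring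
    have e2 : ∑ j, (2 * Real.pi * I * (k j)) * (I * F' j) = I * ∑ j, (2 * Real.pi * I * (k j)) * F' j := by
      rw [Finset.mul_sum]; exact Finset.sum_congr rfl fun j _ => by ring
    rw [e1, e2]
    ring
  simp only [symbT_smul, inner_smul_right] at hI
  simp only [pull, I_mul_re] at hI
  rw [integral_neg, ← neg_add, neg_inj] at hI
  apply Complex.ext
  · rw [h1, Complex.add_re, re_integral_eq hBt]
  · rw [hI, Complex.add_im, im_integral_eq hBt]

end IsWeakTensorPassiveVectorDistortedOn

end ModeIdentity

/-! ## §5 The distorted constraint in Fourier variables (constant frame) -/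

section Constraint

/-- **Fourier coefficients commute with a constant real matrix**: for an integrable field `v`,
`𝓕(G₀ • v)(k) = G₀ • v̂(k)` (`G₀ • z = Matrix.toEuclideanCLM (G₀.map ofReal) z`; linearity of the Fourier
coefficient under a constant linear map of the fibre). [cite: Grafakos2014, §3.1.1] -/
theorem mFourierCoeff_distort_const {v : UnitAddTorus d → EuclideanSpace ℝ d} (hv : Integrable v volume)
    (G₀ : Matrix d d ℝ) (k : d → ℤ) :
    mFourierCoeff (FunctionSpaces.EuclideanSpace.complexify ∘ distort (fun _ => G₀) v) k =
      Matrix.toEuclideanCLM (n := d) (𝕜 := ℂ) (G₀.map Complex.ofReal)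
        (mFourierCoeff (FunctionSpaces.EuclideanSpace.complexify ∘ v) k) := by
  set L : EuclideanSpace ℂ d →L[ℂ] EuclideanSpace ℂ d := Matrix.toEuclideanCLM (n := d) (𝕜 := ℂ) (G₀.map Complex.ofReal) with hL
  have hpt : ∀ x, FunctionSpaces.EuclideanSpace.complexify (distort (fun _ => G₀) v x) =
      L (FunctionSpaces.EuclideanSpace.complexify (v x)) := by
    intro x
    ext a
    rw [FunctionSpaces.EuclideanSpace.complexify_apply, distort_apply, hL, toEuclideanCLM_map_ofReal_apply]
    push_cast
    exact Finset.sum_congr rfl fun b' _ => by rw [FunctionSpaces.EuclideanSpace.complexify_apply]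
  rw [FunctionSpaces.Torus.mFourierCoeff_eq_integral_volume, FunctionSpaces.Torus.mFourierCoeff_eq_integral_volume]
  have hi : Integrable (fun x => mFourier (-k) x • FunctionSpaces.EuclideanSpace.complexify (v x)) volume :=
    ((FunctionSpaces.EuclideanSpace.complexify (ι := d)).toContinuousLinearMap.integrable_comp hv).bdd_smul 1
      (mFourier (-k)).continuous.aestronglyMeasurable
      (Eventually.of_forall fun x => ((mFourier (-k)).norm_coe_le_norm x).trans_eq mFourier_norm)
  have e2 : (∫ x, mFourier (-k) x • (⇑FunctionSpaces.EuclideanSpace.complexify ∘ v) x) =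
      ∫ x, mFourier (-k) x • FunctionSpaces.EuclideanSpace.complexify (v x) := rfl
  rw [e2, ← ContinuousLinearMap.integral_comp_comm L hi]
  refine integral_congr_ae (Eventually.of_forall fun x => ?_)
  simp only [Function.comp_apply]
  rw [hpt x, ContinuousLinearMap.map_smul]

namespace IsWeakTensorPassiveVectorDistortedOn

variable {A T : ℝ} {𝔸 : Visc4 d} {b w : ℝ → UnitAddTorus d → EuclideanSpace ℝ d}
  {G₀ : Matrix d d ℝ} {w₀ : UnitAddTorus d → EuclideanSpace ℝ d}

/-- **The constant-frame constraint mode by mode**: for a.e. `t ∈ (0,T)` and every `k ∈ ℤ^d`, the mode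
`ŵ(t)(k)` is transversal to the twisted frequency `G₀ᵀk`: `Σ_b (Σ_a k_a G₀ab) ŵ(t)(k)_b = 0`
(`∇·(G₀ w(t)) = 0` weakly, `𝓕(G₀ • w(t)) = G₀ • ŵ(t)`, Robinson–Rodrigo–Sadowski Ex. 2.14).
[cite: RobinsonRodrigoSadowski2016, Ex. 2.14 (solution p. 310)] -/
theorem ae_sum_vecMul_mul_mFourierCoeff_eq_zero
    (h : IsWeakTensorPassiveVectorDistortedOn A T 𝔸 b (fun _ _ => G₀) w₀ w) :
    ∀ᵐ t ∂(volume.restrict (Ioo 0 T)), ∀ k : d → ℤ,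
      ∑ b', ((Matrix.vecMul (fun a => (k a : ℝ)) G₀ b' : ℝ) : ℂ) *
        mFourierCoeff (FunctionSpaces.EuclideanSpace.complexify ∘ w t) k b' = 0 := by
  filter_upwards [h.ae_isWeaklyDivFree_distort, h.ae_memLp_two] with t hdiv h2 k
  have h2' : MemLp (distort (fun _ => G₀) (w t)) 2 volume := by
    have e : distort (fun (_ : UnitAddTorus d) => G₀) (w t) =
        fun x => (Matrix.toEuclideanCLM (n := d) (𝕜 := ℝ) G₀) (w t x) := by
      funext x
      ext a
      rw [distort_apply, show Matrix.toEuclideanCLM (n := d) (𝕜 := ℝ) G₀ (w t x) a =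
        WithLp.ofLp (Matrix.toEuclideanCLM (n := d) (𝕜 := ℝ) G₀ (w t x)) a from rfl, Matrix.ofLp_toEuclideanCLM]
      simp [Matrix.mulVec, dotProduct]
    rw [e]
    exact ContinuousLinearMap.comp_memLp' _ h2
  have key := FunctionSpaces.Torus.IsWeaklyDivFree.sum_mul_mFourierCoeff_eq_zero h2' hdiv k
  rw [mFourierCoeff_distort_const (h2.integrable one_le_two) G₀ k] at key
  simp_rw [toEuclideanCLM_map_ofReal_apply, Finset.mul_sum] at key
  rw [Finset.sum_comm] at key
  rw [← key]
  refine Finset.sum_congr rfl fun b' _ => ?_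
  rw [ofReal_vecMul_intCast_apply, Finset.sum_mul]
  exact Finset.sum_congr rfl fun a _ => by ring

end IsWeakTensorPassiveVectorDistortedOn

end Constraint

end Torus

end Literature.Analysis.FluidPDE

end
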